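import Summits.AnomalousDissipation.AnomalousDissipation.Theorems.SolenoidalFractalHomogenisationRealisedQuasiStaticCellLawLowSectorInputs
import HarnessLib

/-!
# K2R `RealisedQuasiStaticCellLaw`, line `floquet-bloch`, stub `stub_lowSectorDecay` (S1D): the geometric inputs of the
# weak-coupling roads for an ARBITRARY slot (no positive coupling, no transversality of `ℓ` to `K` required)

Summits-side helper file (everything proved; no definitions, no named facts; `--supports stmt-AnomalousDissipation-20446`).
`weakSector_decay_ae` / `isoSector_decay_ae` need, for EVERY slot `j` of the word, a frame `ζ_j ⊥ ℓ, K_j` with the Leray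
directions `p_J = k̂_J × ζ_j`, no zero and no opposite frequencies on the coset, `|p_J·p_{J+1}| ≤ 1`, and the spectral gap.
`anySlot_inputs` provides them from `ℓ ≠ 0` and `4|ℓ| ≤ |K|` alone (`K = n m`; when `ℓ ∥ K` the normal is taken to a
coordinate plane through `ℓ`): gap `d_J ≥ d₀ + 7/16` (`d₀ ≤ 1/16`, `d_J ≥ 1/2`), `d_{±1} − d₀ ≤ 2`.
-/

set_option linter.dupNamespace false

noncomputable section

namespace Summit.AnomalousDissipation.AnomalousDissipation.Theorems.SolenoidalFractalHomogenisation.RealisedQuasiStaticCellLaw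

open Matrix
open scoped Matrix InnerProductSpace
open Literature.Analysis Literature.Analysis.FunctionSpaces Literature.Analysis.FunctionSpaces.Torus
open Literature.Analysis.FluidPDE Literature.Analysis.FluidPDE.LatticeShear

/-- A real unit vector orthogonal to a nonzero `u` and to every `v` with `u × v = 0` or not: precisely, for `u ≠ 0` and any `v`
there is `ζ` with `ζ·ζ = 1`, `ζ·u = 0`, `ζ·v = 0`. -/
theorem exists_unit_normal_any (u v : Fin 3 → ℝ) (hu : u ≠ 0) :
    ∃ ζ : Fin 3 → ℝ, ζ ⬝ᵥ ζ = 1 ∧ ζ ⬝ᵥ u = 0 ∧ ζ ⬝ᵥ v = 0 := by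
  by_cases h : u ⨯₃ v ≠ 0
  · exact exists_unit_normal u v h
  · push Not at h
    -- `v` is parallel to `u`: `(u·u) v = (u·v) u`
    have huu : 0 < u ⬝ᵥ u := by
      obtain ⟨i, hi⟩ : ∃ i, u i ≠ 0 := by
        by_contra h0
        push Not at h0
        exact hu (funext h0)
      have e : u ⬝ᵥ u = ∑ l, u l ^ 2 := by simp [dotProduct, sq]
      rw [e]
      exact lt_of_lt_of_le (by positivity) (Finset.single_le_sum (fun l _ => sq_nonneg (u l)) (Finset.mem_univ i))
    have hpar : (u ⬝ᵥ u) • v = (u ⬝ᵥ v) • u := by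
      have h1 : u ⨯₃ (u ⨯₃ v) = (u ⬝ᵥ v) • u - (u ⬝ᵥ u) • v := cross_cross_eq_smul_sub_smul' u u v
      rw [h, map_zero] at h1
      exact (sub_eq_zero.1 h1.symm).symm
    -- a coordinate vector not parallel to `u`
    obtain ⟨w, hw⟩ : ∃ w : Fin 3 → ℝ, u ⨯₃ w ≠ 0 := by
      by_contra h0
      push Not at h0
      have h1 := h0 (Pi.single 0 1)
      have h2 := h0 (Pi.single 1 1)
      rw [cross_apply] at h1 h2
      have a2 : u 2 = 0 := by have := congrFun h1 1; simpa [Pi.single_apply] using this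
      have a1 : u 1 = 0 := by have := congrFun h1 2; simpa [Pi.single_apply] using this
      have a0 : u 0 = 0 := by have := congrFun h2 2; simpa [Pi.single_apply] using this
      apply hu
      funext i
      fin_cases i <;> simp [a0, a1, a2]
    obtain ⟨ζ, hζ1, hζu, _⟩ := exists_unit_normal u w hw
    refine ⟨ζ, hζ1, hζu, ?_⟩
    have := congrArg (fun x => ζ ⬝ᵥ x) hpar
    simp only [dotProduct_smul, smul_eq_mul, hζu, mul_zero] at this
    rcases mul_eq_zero.1 this with h0 | h0
    · exact absurd h0 huu.ne'
    · exact h0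

/-- **Geometric inputs of the weak-coupling roads, any slot.** -/
theorem anySlot_inputs (P : LatticePhase) {n : ℕ} (hn : 0 < n) {ℓ : Fin 3 → ℤ} (hℓ : ℓ ≠ 0)
    (h4 : 4 * ‖latticeVec ℓ‖ ≤ ‖latticeVec (fun i => P.m i * (n : ℤ))‖) :
    ∃ ζr : Fin 3 → ℝ, ∃ p : ℤ → Fin 3 → ℝ,
      (∀ J : ℤ, ℓ + J • (fun i => P.m i * (n : ℤ)) ≠ 0) ∧
      (∀ J J' : ℤ, ℓ + J • (fun i => P.m i * (n : ℤ)) ≠ -(ℓ + J' • (fun i => P.m i * (n : ℤ)))) ∧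
      ζr ⬝ᵥ ζr = 1 ∧ ζr ⬝ᵥ (fun i => ((ℓ i : ℤ) : ℝ)) = 0 ∧
      ζr ⬝ᵥ (fun i => (((fun i => P.m i * (n : ℤ)) i : ℤ) : ℝ)) = 0 ∧
      (∀ J : ℤ, p J = (Real.sqrt ((fun i => (((ℓ + J • (fun i => P.m i * (n : ℤ))) i : ℤ) : ℝ)) ⬝ᵥ
        (fun i => (((ℓ + J • (fun i => P.m i * (n : ℤ))) i : ℤ) : ℝ))))⁻¹ •
        (fun i => (((ℓ + J • (fun i => P.m i * (n : ℤ))) i : ℤ) : ℝ)) ⨯₃ ζr) ∧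
      (∀ J : ℤ, |p J ⬝ᵥ p (J + 1)| ≤ 1) ∧
      freqNormSq ℓ / freqNormSq (fun i => P.m i * (n : ℤ)) ≤ 1 / 16 ∧
      (∀ J : ℤ, J ≠ 0 → freqNormSq ℓ / freqNormSq (fun i => P.m i * (n : ℤ)) + 7 / 16 ≤
        freqNormSq (ℓ + J • (fun i => P.m i * (n : ℤ))) / freqNormSq (fun i => P.m i * (n : ℤ))) ∧
      freqNormSq (ℓ + (1 : ℤ) • (fun i => P.m i * (n : ℤ))) / freqNormSq (fun i => P.m i * (n : ℤ)) ≤ 2 ∧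
      freqNormSq (ℓ + (-1 : ℤ) • (fun i => P.m i * (n : ℤ))) / freqNormSq (fun i => P.m i * (n : ℤ)) ≤ 2 := by
  set K : Fin 3 → ℤ := fun i => P.m i * (n : ℤ) with hK
  have hK0 : K ≠ 0 := cellFreq_ne_zero P hn
  have hb1 : 1 ≤ ‖latticeVec K‖ := one_le_norm_latticeVec hK0
  have hℓ1 : 1 ≤ ‖latticeVec ℓ‖ := one_le_norm_latticeVec hℓ
  -- no zero frequency on the coset
  have hk : ∀ J : ℤ, ℓ + J • K ≠ 0 := by
    intro J h0
    have e : latticeVec ℓ = -((J : ℝ) • latticeVec K) := by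
      have h1 : latticeVec (ℓ + J • K) = (0 : EuclideanSpace ℝ (Fin 3)) := by
        rw [h0]; ext i; simp
      rw [latticeVec_coset] at h1
      exact eq_neg_of_add_eq_zero_left h1
    by_cases hJ : J = 0
    · rw [hJ] at e; simp at e
      rw [e, norm_zero] at hℓ1; linarith
    · have hJ1 : (1 : ℝ) ≤ |(J : ℝ)| := by rw [← Int.cast_abs]; exact_mod_cast Int.one_le_abs hJ
      have : ‖latticeVec ℓ‖ = |(J : ℝ)| * ‖latticeVec K‖ := by rw [e, norm_neg, norm_smul, Real.norm_eq_abs]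
      nlinarith
  -- no opposite frequencies on the coset
  have hdisj : ∀ J J' : ℤ, ℓ + J • K ≠ -(ℓ + J' • K) := by
    intro J J' h0
    have e : (2 : ℝ) • latticeVec ℓ = -(((J + J' : ℤ) : ℝ) • latticeVec K) := by
      have h1 : latticeVec (ℓ + J • K) + latticeVec (ℓ + J' • K) = 0 := by
        rw [h0, ← latticeVec_add, neg_add_cancel]; ext i; simp
      rw [latticeVec_coset, latticeVec_coset] at h1
      have : (2 : ℝ) • latticeVec ℓ + ((J + J' : ℤ) : ℝ) • latticeVec K = 0 := by
        rw [two_smul, Int.cast_add, add_smul, ← h1]; abel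
      exact eq_neg_of_add_eq_zero_left this
    by_cases hJ : J + J' = 0
    · rw [hJ] at e; simp at e
      rw [e, norm_zero] at hℓ1; linarith
    · have hJ1 : (1 : ℝ) ≤ |((J + J' : ℤ) : ℝ)| := by rw [← Int.cast_abs]; exact_mod_cast Int.one_le_abs hJ
      have h2 : 2 * ‖latticeVec ℓ‖ = |((J + J' : ℤ) : ℝ)| * ‖latticeVec K‖ := by
        have := congrArg (fun v => ‖v‖) e
        simp only [norm_smul, norm_neg, Real.norm_eq_abs] at this
        simpa using this
      nlinarith
  -- the unit normal (any slot)
  have hℓr : (fun i => ((ℓ i : ℤ) : ℝ)) ≠ 0 := by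
    intro h0
    apply hℓ
    funext i
    have h1 : ((ℓ i : ℤ) : ℝ) = 0 := congrFun h0 i
    exact_mod_cast h1
  obtain ⟨ζr, hζ1, hζ0, hζK⟩ := exists_unit_normal_any (fun i => ((ℓ i : ℤ) : ℝ)) (fun i => ((K i : ℤ) : ℝ)) hℓr
  -- the frame
  set p : ℤ → Fin 3 → ℝ := fun J => (Real.sqrt ((fun i => (((ℓ + J • K) i : ℤ) : ℝ)) ⬝ᵥ
      (fun i => (((ℓ + J • K) i : ℤ) : ℝ))))⁻¹ • (fun i => (((ℓ + J • K) i : ℤ) : ℝ)) ⨯₃ ζr with hp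
  have hpJ : ∀ J : ℤ, p J = (Real.sqrt ((fun i => (((ℓ + J • K) i : ℤ) : ℝ)) ⬝ᵥ
      (fun i => (((ℓ + J • K) i : ℤ) : ℝ))))⁻¹ • (fun i => (((ℓ + J • K) i : ℤ) : ℝ)) ⨯₃ ζr := fun J => rfl
  have hs : ∀ J : ℤ, |p J ⬝ᵥ p (J + 1)| ≤ 1 := fun J =>
    abs_inPlane_link_le_one (ℓ + J • K) (ℓ + (J + 1) • K) hζ1 (zeta_dot_coset hζ0 hζK J) (zeta_dot_coset hζ0 hζK (J + 1))
  obtain ⟨_, hd, hd1, hdm1⟩ := ladder_diag_bounds hK0 h4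
  -- `d₀ ≤ 1/16`
  have hd0 : freqNormSq ℓ / freqNormSq K ≤ 1 / 16 := by
    have hKsq : freqNormSq K = ‖latticeVec K‖ ^ 2 := by rw [← norm_latticeVec_sq]
    have hℓsq : freqNormSq ℓ = ‖latticeVec ℓ‖ ^ 2 := by rw [← norm_latticeVec_sq]
    have hKpos : 0 < freqNormSq K := by rw [hKsq]; positivity
    rw [div_le_iff₀ hKpos, hℓsq, hKsq]
    nlinarith [norm_nonneg (latticeVec ℓ)]
  refine ⟨ζr, p, hk, hdisj, hζ1, hζ0, hζK, hpJ, hs, hd0, fun J hJ => ?_, hd1, hdm1⟩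
  have := hd J hJ
  linarith

end Summit.AnomalousDissipation.AnomalousDissipation.Theorems.SolenoidalFractalHomogenisation.RealisedQuasiStaticCellLaw

end
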